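import Summits.BirchSwinnertonDyer.BirchSwinnertonDyer.Theorems.ClassRecordThreeEulerHalvesAtThreeCartanTransportResidueMaps
import HarnessLib

/-!
# TRANSPORT behind NUM, brick H2 (index half): the residue algebra `k_q := ψ_q(O)` of a Cartan order has `q²` elements

Helper file `--supports stmt-BirchSwinnertonDyer-19109 --as helper` (seat `bsd-idea-10` g17, lens transfer; crux `EulerHalvesAtThree` ∕ residue crux 23422
line `cartan`, node (F2b♮) ⟺ NUM; road memo `Cruxes/EulerHalvesAtThree/TRANSPORT-HULL.md` §3.5, brick H2 = «residue description of the Cartan order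
from the five axioms»; this file is its COUNTING half, the structure half (`k_q = 𝔽_q[η_q]`, `η_q` without rational eigenvalue, pinning) follows).
SETTING: `X : CartanLevelCurveData D M C` (hull `O₀` Eichler of level `M`, Cartan order `O ⊆ O₀` with `(∏ C)·O₀ ⊆ O`, `[O₀ : O] = ∏_{q ∈ C} q²`,
SATURATED, DIVISION modulo each `q ∈ C`), and a residue model `ψ : B → M₂(𝔽_q)` of `O₀` at `q ∈ C` (`IsMatrixResidueMap`, brick H1). The residue algebra
of `O` at `q` is the additive subgroup `k_q := ψ(O) = ((O.addSubgroupOf O₀).map ψ) ⊆ M₂(𝔽_q)` (spelled out; no new definition), and the LEVEL GROUP at `q`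
is `K_q := O + q·O₀` (spelled `O ⊔ (q • ·)(O₀)`). THIS FILE (all PROVED):
* §1 (any order pair `O ⊆ O₁`, residue model of `O₁`): `mem_image_iff`; `k` contains the scalars and is closed under products and `𝔽_q`-multiples
  (`smul_one_mem_image`, `mul_mem_image`, `smul_mem_image`); `mem_preim_image_iff` ∕ `preim_image_eq` (`ψ⁻¹(k) ∩ O₁ = O₁ ∩ K`); `relIndex_sup_eq_index_image`
  (`[O₁ : K] = [M₂(𝔽_q) : k]`), `index_image_dvd` (`∣ q⁴`), `index_image_mul_natCard`;
* §2 (abstract): `relIndex_inf_eq_mul_of_coprime`, `relIndex_iInf_eq_prod` — the index of a finite meet of subgroups of pairwise coprime finite index is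
  the product of the indices;
* §3 (Cartan data): `toAddSubgroup_eq_iInf` (`O = O₀ ∩ ⋂_{p ∈ C} K_p`, = SATURATION), **`relIndex_level_eq`** (`[O₀ : K_q] = q²` for `q ∈ C`: the indices
  `[O₀ : K_p] ∣ p⁴` are pairwise coprime, their product is `[O₀ : O] = ∏ p²`, compare `q`-adic valuations), **`index_image_eq`**, **`natCard_image_eq`**
  (`|k_q| = q²`).
HONEST FRAMING: bookkeeping (index arithmetic); nothing about NUM, crux 23422 ∕ 19109 or any summit statement is proved by this seat; BSD is proved
for no curve. [folklore]
-/

set_option linter.dupNamespace false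
set_option autoImplicit false

noncomputable section

namespace Summit.BirchSwinnertonDyer.BirchSwinnertonDyer.Theorems.CartanTransport.ResidueIndex

open Literature.NumberTheory.Automorphic

universe u

/-! ## §1 The residue algebra `ψ(O)` of a suborder and the level group `O + q O₁` -/

section General

variable {B : Type u} [Ring B]
variable {O O₁ : Submodule ℤ B} {p : ℕ} [Fact p.Prime] {ψ : B → Matrix (Fin 2) (Fin 2) (ZMod p)}

/-- PROVED: membership in the residue algebra `ψ(O) = (O.addSubgroupOf O₁).map ψ`. [folklore] -/
theorem mem_image_iff (h : IsMatrixResidueMap O₁ p ψ) (hle : O ≤ O₁) {m : Matrix (Fin 2) (Fin 2) (ZMod p)} :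
    m ∈ (O.toAddSubgroup.addSubgroupOf O₁.toAddSubgroup).map h.addHom ↔ ∃ a ∈ O, ψ a = m := by
  constructor
  · rintro ⟨x, hx, rfl⟩
    exact ⟨x, AddSubgroup.mem_addSubgroupOf.mp hx, rfl⟩
  · rintro ⟨a, ha, rfl⟩
    exact ⟨⟨a, hle ha⟩, AddSubgroup.mem_addSubgroupOf.mpr ha, rfl⟩

/-- PROVED: `ψ(O)` contains every scalar matrix (`1 ∈ O`). [folklore] -/
theorem smul_one_mem_image (h : IsMatrixResidueMap O₁ p ψ) (hle : O ≤ O₁) (hone : (1 : B) ∈ O) (c : ZMod p) :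
    c • (1 : Matrix (Fin 2) (Fin 2) (ZMod p)) ∈ (O.toAddSubgroup.addSubgroupOf O₁.toAddSubgroup).map h.addHom := by
  obtain ⟨n, rfl⟩ := ZMod.intCast_surjective c
  exact (mem_image_iff h hle).mpr ⟨(n : ℤ) • 1, O.smul_mem n hone, by rw [h.map_zsmul (hle hone), h.map_one, Int.cast_smul_eq_zsmul]⟩

/-- PROVED: `ψ(O)` is closed under products (`O` is). [folklore] -/
theorem mul_mem_image (h : IsMatrixResidueMap O₁ p ψ) (hle : O ≤ O₁) (hmul : ∀ a ∈ O, ∀ b ∈ O, a * b ∈ O)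
    {m m' : Matrix (Fin 2) (Fin 2) (ZMod p)} (hm : m ∈ (O.toAddSubgroup.addSubgroupOf O₁.toAddSubgroup).map h.addHom)
    (hm' : m' ∈ (O.toAddSubgroup.addSubgroupOf O₁.toAddSubgroup).map h.addHom) :
    m * m' ∈ (O.toAddSubgroup.addSubgroupOf O₁.toAddSubgroup).map h.addHom := by
  obtain ⟨a, ha, rfl⟩ := (mem_image_iff h hle).mp hm
  obtain ⟨b, hb, rfl⟩ := (mem_image_iff h hle).mp hm'
  exact (mem_image_iff h hle).mpr ⟨a * b, hmul a ha b hb, h.map_mul a (hle ha) b (hle hb)⟩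

/-- PROVED: `ψ(O)` is closed under `𝔽_p`-multiples. [folklore] -/
theorem smul_mem_image (h : IsMatrixResidueMap O₁ p ψ) (hle : O ≤ O₁) (hone : (1 : B) ∈ O) (hmul : ∀ a ∈ O, ∀ b ∈ O, a * b ∈ O)
    (c : ZMod p) {m : Matrix (Fin 2) (Fin 2) (ZMod p)} (hm : m ∈ (O.toAddSubgroup.addSubgroupOf O₁.toAddSubgroup).map h.addHom) :
    c • m ∈ (O.toAddSubgroup.addSubgroupOf O₁.toAddSubgroup).map h.addHom := by
  have := mul_mem_image h hle hmul (smul_one_mem_image h hle hone c) hm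
  rwa [smul_one_mul] at this

/-- PROVED: **`ψ⁻¹(ψ(O)) ∩ O₁ = {x ∈ O₁ : x ≡ a (mod p O₁) for some a ∈ O}`**. [folklore] -/
theorem mem_preim_image_iff (h : IsMatrixResidueMap O₁ p ψ) (hle : O ≤ O₁) {x : B} :
    x ∈ h.preim ((O.toAddSubgroup.addSubgroupOf O₁.toAddSubgroup).map h.addHom) ↔
      x ∈ O₁ ∧ ∃ a ∈ O, ∃ y ∈ O₁, x - a = (p : ℤ) • y := by
  rw [h.mem_preim_iff, mem_image_iff h hle]
  constructor
  · rintro ⟨hx, a, ha, hax⟩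
    obtain ⟨y, hy, hxy⟩ := (h.ker (x - a) (O₁.sub_mem hx (hle ha))).mp (by rw [h.map_sub hx (hle ha), hax, sub_self])
    exact ⟨hx, a, ha, y, hy, hxy⟩
  · rintro ⟨hx, a, ha, y, hy, hxy⟩
    refine ⟨hx, a, ha, ?_⟩
    have hx' : x = a + (p : ℤ) • y := by rw [← hxy]; abel
    rw [hx', h.map_add a (hle ha) _ (O₁.smul_mem _ hy), h.map_smul_eq_zero hy, add_zero]

/-- PROVED: `O ⊆ ψ⁻¹(ψ(O))`. [folklore] -/
theorem le_preim_image (h : IsMatrixResidueMap O₁ p ψ) (hle : O ≤ O₁) :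
    O ≤ h.preim ((O.toAddSubgroup.addSubgroupOf O₁.toAddSubgroup).map h.addHom) :=
  fun a ha => ⟨hle ha, (mem_image_iff h hle).mpr ⟨a, ha, rfl⟩⟩

/-- PROVED: **`ψ⁻¹(ψ(O)) ∩ O₁ = O₁ ∩ (O + p O₁)`** — the preimage of the residue algebra is the LEVEL GROUP, independently of `ψ`. [folklore] -/
theorem preim_image_eq (h : IsMatrixResidueMap O₁ p ψ) (hle : O ≤ O₁) :
    (h.preim ((O.toAddSubgroup.addSubgroupOf O₁.toAddSubgroup).map h.addHom)).toAddSubgroup =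
      O₁.toAddSubgroup ⊓ (O.toAddSubgroup ⊔ O₁.toAddSubgroup.map (zsmulAddGroupHom (p : ℤ))) := by
  ext x
  rw [Submodule.mem_toAddSubgroup, mem_preim_image_iff h hle, AddSubgroup.mem_inf, Submodule.mem_toAddSubgroup, AddSubgroup.mem_sup]
  constructor
  · rintro ⟨hx, a, ha, y, hy, hxy⟩
    exact ⟨hx, a, ha, (p : ℤ) • y, AddSubgroup.mem_map.mpr ⟨y, hy, rfl⟩, by rw [← hxy]; abel⟩
  · rintro ⟨hx, a, ha, z, hz, haz⟩
    obtain ⟨y, hy, rfl⟩ := AddSubgroup.mem_map.mp hz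
    exact ⟨hx, a, ha, y, hy, by rw [← haz, zsmulAddGroupHom_apply]; abel⟩

/-- PROVED: **`[O₁ : O + p O₁] = [M₂(𝔽_p) : ψ(O)]`**. [folklore] -/
theorem relIndex_sup_eq_index_image (h : IsMatrixResidueMap O₁ p ψ) (hle : O ≤ O₁) :
    (O.toAddSubgroup ⊔ O₁.toAddSubgroup.map (zsmulAddGroupHom (p : ℤ))).relIndex O₁.toAddSubgroup =
      ((O.toAddSubgroup.addSubgroupOf O₁.toAddSubgroup).map h.addHom).index := by
  rw [← h.relIndex_preim, preim_image_eq h hle, AddSubgroup.inf_relIndex_left]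

/-- PROVED: `[M₂(𝔽_p) : ψ(O)] ∣ p⁴`. [folklore] -/
theorem index_image_dvd (h : IsMatrixResidueMap O₁ p ψ) :
    ((O.toAddSubgroup.addSubgroupOf O₁.toAddSubgroup).map h.addHom).index ∣ p ^ 4 := by
  have := ((O.toAddSubgroup.addSubgroupOf O₁.toAddSubgroup).map h.addHom).index_dvd_card
  rwa [IsMatrixResidueMap.natCard_matrix_fin_two, ZMod.card] at this

/-- PROVED: `[M₂(𝔽_p) : ψ(O)] · |ψ(O)| = p⁴`. [folklore] -/
theorem index_image_mul_natCard (h : IsMatrixResidueMap O₁ p ψ) :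
    ((O.toAddSubgroup.addSubgroupOf O₁.toAddSubgroup).map h.addHom).index *
      Nat.card ((O.toAddSubgroup.addSubgroupOf O₁.toAddSubgroup).map h.addHom) = p ^ 4 := by
  rw [AddSubgroup.index_mul_card, IsMatrixResidueMap.natCard_matrix_fin_two, ZMod.card]

end General

/-! ## §2 Index of a meet of subgroups of pairwise coprime index -/

section Index

variable {G : Type*} [AddGroup G]

/-- PROVED: `[L : H ∩ K] = [L : H]·[L : K]` for subgroups of finite coprime index. [folklore] -/
theorem relIndex_inf_eq_mul_of_coprime {H K L : AddSubgroup G} (hH : H.relIndex L ≠ 0) (hK : K.relIndex L ≠ 0)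
    (hc : Nat.Coprime (H.relIndex L) (K.relIndex L)) : (H ⊓ K).relIndex L = H.relIndex L * K.relIndex L :=
  le_antisymm AddSubgroup.relIndex_inf_le
    (Nat.le_of_dvd (Nat.pos_of_ne_zero (AddSubgroup.relIndex_inf_ne_zero hH hK))
      (hc.mul_dvd_of_dvd_of_dvd (AddSubgroup.relIndex_dvd_of_le_left L inf_le_left)
        (AddSubgroup.relIndex_dvd_of_le_left L inf_le_right)))

/-- PROVED: **the index of a finite meet of subgroups of pairwise coprime finite index is the product of the indices**. [folklore] -/
theorem relIndex_iInf_eq_prod {ι : Type*} [DecidableEq ι] (K : ι → AddSubgroup G) (L : AddSubgroup G) (s : Finset ι)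
    (hne : ∀ i ∈ s, (K i).relIndex L ≠ 0)
    (hc : ∀ i ∈ s, ∀ j ∈ s, i ≠ j → Nat.Coprime ((K i).relIndex L) ((K j).relIndex L)) :
    (⨅ i ∈ s, K i).relIndex L = ∏ i ∈ s, (K i).relIndex L := by
  induction s using Finset.induction_on with
  | empty => simp [AddSubgroup.relIndex_top_left]
  | insert a s ha ih =>
    have ih' := ih (fun i hi => hne i (Finset.mem_insert_of_mem hi))
      (fun i hi j hj hij => hc i (Finset.mem_insert_of_mem hi) j (Finset.mem_insert_of_mem hj) hij)
    rw [Finset.iInf_insert, Finset.prod_insert ha, ← ih']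
    refine relIndex_inf_eq_mul_of_coprime (hne a (Finset.mem_insert_self a s)) ?_ ?_
    · rw [ih']
      exact Finset.prod_ne_zero_iff.mpr fun i hi => hne i (Finset.mem_insert_of_mem hi)
    · rw [ih']
      exact Nat.Coprime.prod_right fun i hi =>
        hc a (Finset.mem_insert_self a s) i (Finset.mem_insert_of_mem hi) fun hai => ha (hai ▸ hi)

end Index

/-! ## §3 Cartan data: `[O₀ : O + q O₀] = q²` and `|ψ_q(O)| = q²` -/

section Cartan

variable {D M : ℕ} {C : Finset ℕ}

/-- PROVED — **SATURATION as an intersection**: `O = O₀ ∩ ⋂_{p ∈ C} (O + p O₀)`. [folklore] -/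
theorem toAddSubgroup_eq_iInf (X : CartanLevelCurveData D M C) :
    X.O.toAddSubgroup = X.O₀.toAddSubgroup ⊓ ⨅ p ∈ C, (X.O.toAddSubgroup ⊔ X.O₀.toAddSubgroup.map (zsmulAddGroupHom (p : ℤ))) := by
  apply le_antisymm
  · exact le_inf (fun x hx => X.le hx) (le_iInf₂ fun p _ => le_sup_left)
  · intro x hx
    obtain ⟨hx0, hx⟩ := AddSubgroup.mem_inf.mp hx
    refine X.saturated x hx0 fun p hp => ?_
    have hxp := AddSubgroup.mem_iInf.mp (AddSubgroup.mem_iInf.mp hx p) hp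
    obtain ⟨a, ha, z, hz, haz⟩ := AddSubgroup.mem_sup.mp hxp
    obtain ⟨y, hy, rfl⟩ := AddSubgroup.mem_map.mp hz
    exact ⟨a, ha, y, hy, by rw [← haz, zsmulAddGroupHom_apply]; abel⟩

/-- PROVED — **`[O₀ : O + q O₀] = q²` for every Cartan prime `q ∈ C`**: the indices `[O₀ : O + p O₀] ∣ p⁴` (`p ∈ C`) are pairwise coprime, their
product is `[O₀ : O] = ∏_{p ∈ C} p²` (saturation + §2), and `q`-adic valuations are compared. [folklore] -/
theorem relIndex_level_eq (X : CartanLevelCurveData D M C) {q : ℕ} (hq : q ∈ C) :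
    (X.O.toAddSubgroup ⊔ X.O₀.toAddSubgroup.map (zsmulAddGroupHom (q : ℤ))).relIndex X.O₀.toAddSubgroup = q ^ 2 := by
  classical
  obtain ⟨K, hK⟩ : ∃ K : ℕ → AddSubgroup X.B, ∀ p, K p = X.O.toAddSubgroup ⊔ X.O₀.toAddSubgroup.map (zsmulAddGroupHom (p : ℤ)) :=
    ⟨_, fun _ => rfl⟩
  have hprime : ∀ p ∈ C, p.Prime := fun p hp => (X.coprime p hp).1
  have hpow : ∀ p ∈ C, ∃ e, e ≤ 4 ∧ (K p).relIndex X.O₀.toAddSubgroup = p ^ e := by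
    intro p hp
    haveI : Fact p.Prime := ⟨hprime p hp⟩
    obtain ⟨ψ, h⟩ := Residue.exists_isMatrixResidueMap_of_mem X hp
    have hdvd : (K p).relIndex X.O₀.toAddSubgroup ∣ p ^ 4 := by
      rw [hK p, relIndex_sup_eq_index_image h X.le]
      exact index_image_dvd h
    exact (Nat.dvd_prime_pow (hprime p hp)).mp hdvd
  choose! e he using hpow
  have hne : ∀ p ∈ C, (K p).relIndex X.O₀.toAddSubgroup ≠ 0 := fun p hp => by
    rw [(he p hp).2]
    exact pow_ne_zero _ (hprime p hp).ne_zero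
  have hcop : ∀ i ∈ C, ∀ j ∈ C, i ≠ j → Nat.Coprime ((K i).relIndex X.O₀.toAddSubgroup) ((K j).relIndex X.O₀.toAddSubgroup) :=
    fun i hi j hj hij => by
      rw [(he i hi).2, (he j hj).2]
      exact Nat.Coprime.pow _ _ ((Nat.coprime_primes (hprime i hi) (hprime j hj)).mpr hij)
  have hO : X.O.toAddSubgroup = X.O₀.toAddSubgroup ⊓ ⨅ p ∈ C, K p := by
    rw [toAddSubgroup_eq_iInf X]
    simp_rw [hK]
  have hprod : ∏ p ∈ C, p ^ e p = ∏ p ∈ C, p ^ 2 := by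
    calc ∏ p ∈ C, p ^ e p = ∏ p ∈ C, (K p).relIndex X.O₀.toAddSubgroup := Finset.prod_congr rfl fun p hp => (he p hp).2.symm
      _ = (⨅ p ∈ C, K p).relIndex X.O₀.toAddSubgroup := (relIndex_iInf_eq_prod K _ C hne hcop).symm
      _ = X.O.toAddSubgroup.relIndex X.O₀.toAddSubgroup := by rw [hO, AddSubgroup.inf_relIndex_left]
      _ = ∏ p ∈ C, p ^ 2 := X.relIndex_eq
  have hsplit : ∀ f : ℕ → ℕ, ∏ p ∈ C, p ^ f p = q ^ f q * ∏ p ∈ C.erase q, p ^ f p := fun f =>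
    (Finset.mul_prod_erase C (fun p => p ^ f p) hq).symm
  have hnd : ∀ f : ℕ → ℕ, ¬ q ∣ ∏ p ∈ C.erase q, p ^ f p := by
    intro f hdvd
    obtain ⟨p, hp, hpd⟩ := (Prime.dvd_finsetProd_iff (hprime q hq).prime _).mp hdvd
    have hpq := (Nat.prime_dvd_prime_iff_eq (hprime q hq) (hprime p (Finset.mem_of_mem_erase hp))).mp
      ((hprime q hq).dvd_of_dvd_pow hpd)
    exact Finset.ne_of_mem_erase hp hpq.symm
  haveI : Fact q.Prime := ⟨hprime q hq⟩
  have hval : ∀ f : ℕ → ℕ, padicValNat q (∏ p ∈ C, p ^ f p) = f q := by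
    intro f
    rw [hsplit f, padicValNat.mul (pow_ne_zero _ (hprime q hq).ne_zero) (fun h0 => hnd f (by rw [h0]; exact dvd_zero q)), padicValNat.prime_pow,
      padicValNat.eq_zero_of_not_dvd (hnd f), add_zero]
  have heq : e q = 2 := by
    have h1 := hval e
    have h2 := hval fun _ => 2
    rw [hprod] at h1
    exact h1.symm.trans h2
  rw [← hK q, (he q hq).2, heq]

/-- PROVED — **`[M₂(𝔽_q) : ψ(O)] = q²`** for a residue model `ψ` of the hull at a Cartan prime `q ∈ C`. [folklore] -/
theorem index_image_eq (X : CartanLevelCurveData D M C) {q : ℕ} [Fact q.Prime] (hq : q ∈ C)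
    {ψ : X.B → Matrix (Fin 2) (Fin 2) (ZMod q)} (h : IsMatrixResidueMap X.O₀ q ψ) :
    ((X.O.toAddSubgroup.addSubgroupOf X.O₀.toAddSubgroup).map h.addHom).index = q ^ 2 := by
  rw [← relIndex_sup_eq_index_image h X.le, relIndex_level_eq X hq]

/-- PROVED — **`|ψ(O)| = q²`**: the residue algebra of the Cartan order at `q ∈ C` has exactly `q²` elements. [folklore] -/
theorem natCard_image_eq (X : CartanLevelCurveData D M C) {q : ℕ} [Fact q.Prime] (hq : q ∈ C)
    {ψ : X.B → Matrix (Fin 2) (Fin 2) (ZMod q)} (h : IsMatrixResidueMap X.O₀ q ψ) :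
    Nat.card ((X.O.toAddSubgroup.addSubgroupOf X.O₀.toAddSubgroup).map h.addHom) = q ^ 2 := by
  have hq0 : 0 < q ^ 2 := pow_pos (Nat.Prime.pos Fact.out) 2
  have hmul := index_image_mul_natCard (O := X.O) h
  rw [index_image_eq X hq h, show q ^ 4 = q ^ 2 * q ^ 2 by ring] at hmul
  exact Nat.eq_of_mul_eq_mul_left hq0 hmul

end Cartan

end Summit.BirchSwinnertonDyer.BirchSwinnertonDyer.Theorems.CartanTransport.ResidueIndex
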